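import Summits.QuantumAdvantage.QuantumAdvantage.Theorems.SymplecticPurityCubeAlmostBent

/-!
# Crux `DeqThesis`, line `Sketch`, stub `stub_coreFlat` — the Gold-type quadratic Walsh bound

Helper toward the open core stub of the line (`Cruxes/DeqThesis/Lines/Sketch.lean`,
`Lines/Sketch.md` §3): in the lead's analysis of the cube graph state against REAL product tests in
trace-orthonormal value coordinates, the pair phase along an input difference `d` is the quadratic
Boolean function `x ↦ Tr((θ' + d³)·x³ + d·x⁵) + affine`, and the Fourier-side estimate needs its
Walsh spectrum to be `O(√|K|)` UNIFORMLY in `d ≠ 0` and `θ'`. This file proves exactly that, for every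
finite field `K` of order `2ⁿ` (as a `ZMod 2`-algebra):

  `|Σ_x (−1)^{Tr(γ·x + α·x³ + β·x⁵)}| ≤ 4·√2ⁿ`   for `β ≠ 0` and all `α, γ` (`abs_walsh_gold_le`).

Proof (Gold 1968 pattern, as in `SymplecticPurityCubeAlmostBent.lean` for `Tr(αx + βx³)`): square the
sum and substitute `y = x + u`; in characteristic two `(x+u)⁵ = x⁵ + u x⁴ + u⁴ x + u⁵`, so the inner sum
over `x` is the character sum of the ADDITIVE map `x ↦ Tr(αu·x² + αu²·x + βu·x⁴ + βu⁴·x)`; by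
Frobenius invariance of the trace this is `Tr(c_u · x⁴)` with `c_u = β⁴u¹⁶ + α⁴u⁸ + α²u² + βu`, and
`x ↦ x⁴` is a bijection, so the inner sum is `|K|·[c_u = 0]`; the additive polynomial
`β⁴X¹⁶ + α⁴X⁸ + α²X² + βX` has at most `16` roots, whence `W² ≤ 16·|K|`.

References: R. Gold, *Maximal recursive sequences with 3-valued recursive cross-correlation
functions*, IEEE Trans. Inform. Theory 14 (1968), doi:10.1109/TIT.1968.1054106; C. Carlet, *Boolean
Functions for Cryptography and Coding Theory* (CUP 2021), ch. 11 (quadratic functions, Gold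
exponents `2ⁱ + 1`). Everything is proved from Mathlib and the sibling file's character-sum lemmas
(`CubeAlmostBent.e_add`, `trace_sq`, `sum_e_mul_eq_zero`, `sum_e_zero_mul`).
-/

set_option linter.dupNamespace false -- D-0017: single-problem summit ⇒ `QuantumAdvantage.QuantumAdvantage` by design

namespace Summit.QuantumAdvantage.QuantumAdvantage.Theorems.SymplecticPurity

open Finset Polynomial

namespace GoldWalsh

open CubeAlmostBent

/-! ### Characteristic-two identities for the exponent `5 = 4 + 1` -/

section CharTwoFacts

variable {K : Type*} [Field K]

/-- In characteristic two, `(x + u)⁵ = x⁵ + u·x⁴ + u⁴·x + u⁵` (the binomial coefficients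
`C(5,2) = C(5,3) = 10` vanish). -/
theorem fifth_add_eq [CharP K 2] (x u : K) :
    (x + u) ^ 5 = x ^ 5 + u * x ^ 4 + u ^ 4 * x + u ^ 5 := by
  have h2 : (2 : K) = 0 := CharP.cast_eq_zero K 2 ▸ by norm_cast
  linear_combination (2 * x ^ 4 * u + 5 * x ^ 3 * u ^ 2 + 5 * x ^ 2 * u ^ 3 + 2 * x * u ^ 4) * h2

/-- The derivative of `f x = γx + αx³ + βx⁵` along `u`, in characteristic two:
`f x + f (x + u) = (γu + αu³ + βu⁵) + (αu·x² + αu²·x + βu·x⁴ + βu⁴·x)`. -/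
theorem gold_derivative_eq [CharP K 2] (γ α β x u : K) :
    (γ * x + α * x ^ 3 + β * x ^ 5) + (γ * (x + u) + α * (x + u) ^ 3 + β * (x + u) ^ 5) =
      (γ * u + α * u ^ 3 + β * u ^ 5) +
        (α * u * x ^ 2 + α * u ^ 2 * x + β * u * x ^ 4 + β * u ^ 4 * x) := by
  have h2 : (2 : K) = 0 := CharP.cast_eq_zero K 2 ▸ by norm_cast
  rw [fifth_add_eq x u]
  linear_combination (β * x ^ 5 + γ * x + α * x ^ 3 + α * x ^ 2 * u + α * x * u ^ 2) * h2

/-- A finite set of roots of the additive polynomial `β⁴u¹⁶ + α⁴u⁸ + α²u² + βu` with `β ≠ 0` has at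
most sixteen elements. -/
theorem card_le_sixteen_of_additive (α β : K) (hβ : β ≠ 0) (s : Finset K)
    (hs : ∀ u ∈ s, β ^ 4 * u ^ 16 + α ^ 4 * u ^ 8 + α ^ 2 * u ^ 2 + β * u = 0) : s.card ≤ 16 := by
  classical
  set p : K[X] := C (β ^ 4) * X ^ 16 + C (α ^ 4) * X ^ 8 + C (α ^ 2) * X ^ 2 + C β * X with hp
  have hp0 : p ≠ 0 := by
    intro h
    have h16 := congrArg (fun q : K[X] => q.coeff 16) h
    simp only [hp, coeff_add, coeff_C_mul, coeff_X_pow, coeff_X, coeff_zero] at h16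
    norm_num at h16
    exact hβ h16
  have hdeg : p.natDegree ≤ 16 := by
    rw [hp]
    compute_degree
  calc s.card ≤ p.roots.toFinset.card := by
        refine Finset.card_le_card fun u hu => ?_
        rw [Multiset.mem_toFinset, mem_roots hp0, IsRoot.def, hp]
        simp only [eval_add, eval_mul, eval_C, eval_pow, eval_X]
        rw [← hs u hu]
    _ ≤ Multiset.card p.roots := Multiset.toFinset_card_le _
    _ ≤ p.natDegree := card_roots' p
    _ ≤ 16 := hdeg

end CharTwoFacts

/-! ### The squared Walsh sum of `x ↦ Tr(γx + αx³ + βx⁵)` -/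

section Trace

variable {K : Type*} [Field K] [Algebra (ZMod 2) K]

/-- Pointwise identity behind the substitution `y = x + u`:
`(−1)^{Tr(f x)}(−1)^{Tr(f (x+u))} = (−1)^{Tr(γu + αu³ + βu⁵)}(−1)^{Tr(αu x² + αu² x + βu x⁴ + βu⁴ x)}`
for `f x = γx + αx³ + βx⁵`. -/
theorem e_mul_e_shift_gold {e : K → ℝ}
    (he : ∀ z, e z = if Algebra.trace (ZMod 2) K z = 0 then (1 : ℝ) else -1) (γ α β x u : K) :
    e (γ * x + α * x ^ 3 + β * x ^ 5) * e (γ * (x + u) + α * (x + u) ^ 3 + β * (x + u) ^ 5) =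
      e (γ * u + α * u ^ 3 + β * u ^ 5) *
        e (α * u * x ^ 2 + α * u ^ 2 * x + β * u * x ^ 4 + β * u ^ 4 * x) := by
  haveI : CharP K 2 := charP_two_of_algebra
  rw [← e_add he, ← e_add he, gold_derivative_eq]

variable [Fintype K]

/-- Squaring the Walsh sum and substituting `y = x + u`:
`W² = Σ_u (−1)^{Tr(γu + αu³ + βu⁵)} · Σ_x (−1)^{Tr(αu x² + αu² x + βu x⁴ + βu⁴ x)}`. -/
theorem walsh_sq_eq_gold {e : K → ℝ}
    (he : ∀ z, e z = if Algebra.trace (ZMod 2) K z = 0 then (1 : ℝ) else -1) (γ α β : K) :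
    (∑ x : K, e (γ * x + α * x ^ 3 + β * x ^ 5)) ^ 2 =
      ∑ u : K, e (γ * u + α * u ^ 3 + β * u ^ 5) *
        ∑ x : K, e (α * u * x ^ 2 + α * u ^ 2 * x + β * u * x ^ 4 + β * u ^ 4 * x) := by
  rw [sq, Fintype.sum_mul_sum]
  calc ∑ x : K, ∑ y : K, e (γ * x + α * x ^ 3 + β * x ^ 5) * e (γ * y + α * y ^ 3 + β * y ^ 5)
      = ∑ x : K, ∑ u : K, e (γ * u + α * u ^ 3 + β * u ^ 5) *
          e (α * u * x ^ 2 + α * u ^ 2 * x + β * u * x ^ 4 + β * u ^ 4 * x) := by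
        refine Finset.sum_congr rfl fun x _ => ?_
        refine (Fintype.sum_equiv (Equiv.addLeft x) _ _ fun u => ?_).symm
        exact (e_mul_e_shift_gold he γ α β x u).symm
    _ = ∑ u : K, ∑ x : K, e (γ * u + α * u ^ 3 + β * u ^ 5) *
          e (α * u * x ^ 2 + α * u ^ 2 * x + β * u * x ^ 4 + β * u ^ 4 * x) :=
        Finset.sum_comm
    _ = ∑ u : K, e (γ * u + α * u ^ 3 + β * u ^ 5) *
          ∑ x : K, e (α * u * x ^ 2 + α * u ^ 2 * x + β * u * x ^ 4 + β * u ^ 4 * x) :=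
        Finset.sum_congr rfl fun u _ => (Finset.mul_sum _ _ _).symm

/-- `Tr(x⁴) = Tr(x)` (Frobenius invariance twice). -/
theorem trace_pow_four (x : K) :
    Algebra.trace (ZMod 2) K (x ^ 4) = Algebra.trace (ZMod 2) K x := by
  rw [show x ^ 4 = (x ^ 2) ^ 2 by ring, trace_sq, trace_sq]

/-- The inner sum is a linear character sum: by Frobenius invariance of the trace,
`Tr(αu x² + αu² x + βu x⁴ + βu⁴ x) = Tr(c_u · x⁴)` with `c_u = β⁴u¹⁶ + α⁴u⁸ + α²u² + βu`, and
`x ↦ x⁴` is a bijection of `K`. -/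
theorem inner_sum_eq_gold {e : K → ℝ}
    (he : ∀ z, e z = if Algebra.trace (ZMod 2) K z = 0 then (1 : ℝ) else -1) (α β u : K) :
    ∑ x : K, e (α * u * x ^ 2 + α * u ^ 2 * x + β * u * x ^ 4 + β * u ^ 4 * x) =
      ∑ y : K, e ((β ^ 4 * u ^ 16 + α ^ 4 * u ^ 8 + α ^ 2 * u ^ 2 + β * u) * y) := by
  haveI : CharP K 2 := charP_two_of_algebra
  have h1 : ∀ x : K, e (α * u * x ^ 2 + α * u ^ 2 * x + β * u * x ^ 4 + β * u ^ 4 * x) =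
      e ((β ^ 4 * u ^ 16 + α ^ 4 * u ^ 8 + α ^ 2 * u ^ 2 + β * u) * x ^ 4) := by
    intro x
    have ht : Algebra.trace (ZMod 2) K (α * u * x ^ 2 + α * u ^ 2 * x + β * u * x ^ 4 + β * u ^ 4 * x) =
        Algebra.trace (ZMod 2) K ((β ^ 4 * u ^ 16 + α ^ 4 * u ^ 8 + α ^ 2 * u ^ 2 + β * u) * x ^ 4) := by
      -- `Tr(αu x²) = Tr(α²u² x⁴)`, `Tr(αu² x) = Tr(α⁴u⁸ x⁴)`, `Tr(βu⁴ x) = Tr(β⁴u¹⁶ x⁴)`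
      have e1 : Algebra.trace (ZMod 2) K (α * u * x ^ 2) =
          Algebra.trace (ZMod 2) K (α ^ 2 * u ^ 2 * x ^ 4) := by
        rw [← trace_sq (α * u * x ^ 2)]; congr 1; ring
      have e2 : Algebra.trace (ZMod 2) K (α * u ^ 2 * x) =
          Algebra.trace (ZMod 2) K (α ^ 4 * u ^ 8 * x ^ 4) := by
        rw [← trace_pow_four (α * u ^ 2 * x)]; congr 1; ring
      have e3 : Algebra.trace (ZMod 2) K (β * u ^ 4 * x) =
          Algebra.trace (ZMod 2) K (β ^ 4 * u ^ 16 * x ^ 4) := by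
        rw [← trace_pow_four (β * u ^ 4 * x)]; congr 1; ring
      rw [map_add, map_add, map_add, e1, e2, e3, ← map_add, ← map_add, ← map_add]
      congr 1
      ring
    rw [he, he, ht]
  simp_rw [h1]
  have h4 : Function.Bijective fun x : K => x ^ 4 := by
    have hsq2 : Function.Injective fun x : K => x ^ 2 := CharTwo.sq_injective (R := K)
    have : (fun x : K => x ^ 4) = (fun x : K => x ^ 2) ∘ (fun x : K => x ^ 2) := by
      funext x; simp only [Function.comp]; ring
    rw [this]
    exact Finite.injective_iff_bijective.mp (hsq2.comp hsq2)
  exact h4.sum_comp (fun y => e ((β ^ 4 * u ^ 16 + α ^ 4 * u ^ 8 + α ^ 2 * u ^ 2 + β * u) * y))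

/-- **Quadratic Walsh bound for the Gold pair of exponents `3, 5` (abstract form).** For
`|K| = 2ⁿ`, `β ≠ 0` and all `α γ`: `|Σ_x (−1)^{Tr(γx + αx³ + βx⁵)}| ≤ 4·√2ⁿ`. -/
theorem abs_walsh_gold_le' {e : K → ℝ}
    (he : ∀ z, e z = if Algebra.trace (ZMod 2) K z = 0 then (1 : ℝ) else -1)
    {n : ℕ} (hK : Fintype.card K = 2 ^ n) {β : K} (hβ : β ≠ 0) (γ α : K) :
    |∑ x : K, e (γ * x + α * x ^ 3 + β * x ^ 5)| ≤ 4 * Real.sqrt 2 ^ n := by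
  classical
  set W := ∑ x : K, e (γ * x + α * x ^ 3 + β * x ^ 5) with hW
  have hN : (Fintype.card K : ℝ) = 2 ^ n := by exact_mod_cast hK
  have hterm : ∀ u : K,
      |e (γ * u + α * u ^ 3 + β * u ^ 5) *
          ∑ x : K, e (α * u * x ^ 2 + α * u ^ 2 * x + β * u * x ^ 4 + β * u ^ 4 * x)| ≤
        if β ^ 4 * u ^ 16 + α ^ 4 * u ^ 8 + α ^ 2 * u ^ 2 + β * u = 0 then (Fintype.card K : ℝ)
        else 0 := by
    intro u
    rw [inner_sum_eq_gold he, abs_mul]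
    by_cases hu : β ^ 4 * u ^ 16 + α ^ 4 * u ^ 8 + α ^ 2 * u ^ 2 + β * u = 0
    · rw [if_pos hu, hu, sum_e_zero_mul he, Nat.abs_cast]
      calc |e (γ * u + α * u ^ 3 + β * u ^ 5)| * (Fintype.card K : ℝ) ≤ 1 * (Fintype.card K : ℝ) :=
            mul_le_mul_of_nonneg_right (abs_e_le he _) (Nat.cast_nonneg _)
        _ = (Fintype.card K : ℝ) := one_mul _
    · rw [if_neg hu, sum_e_mul_eq_zero he hu, abs_zero, mul_zero]
  have hW2 : W ^ 2 ≤ 16 * (Fintype.card K : ℝ) := by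
    calc W ^ 2 = |W ^ 2| := (abs_of_nonneg (sq_nonneg W)).symm
      _ = |∑ u : K, e (γ * u + α * u ^ 3 + β * u ^ 5) *
            ∑ x : K, e (α * u * x ^ 2 + α * u ^ 2 * x + β * u * x ^ 4 + β * u ^ 4 * x)| := by
          rw [hW, walsh_sq_eq_gold he]
      _ ≤ ∑ u : K, |e (γ * u + α * u ^ 3 + β * u ^ 5) *
            ∑ x : K, e (α * u * x ^ 2 + α * u ^ 2 * x + β * u * x ^ 4 + β * u ^ 4 * x)| :=
          Finset.abs_sum_le_sum_abs _ _
      _ ≤ ∑ u : K, (if β ^ 4 * u ^ 16 + α ^ 4 * u ^ 8 + α ^ 2 * u ^ 2 + β * u = 0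
            then (Fintype.card K : ℝ) else 0) :=
          Finset.sum_le_sum fun u _ => hterm u
      _ = ((Finset.univ.filter fun u : K =>
              β ^ 4 * u ^ 16 + α ^ 4 * u ^ 8 + α ^ 2 * u ^ 2 + β * u = 0).card : ℝ) *
            (Fintype.card K : ℝ) := by
          rw [← Finset.sum_filter, Finset.sum_const, nsmul_eq_mul]
      _ ≤ 16 * (Fintype.card K : ℝ) := by
          gcongr
          exact_mod_cast card_le_sixteen_of_additive α β hβ _
            fun u hu => (Finset.mem_filter.mp hu).2
  have hsq : (4 * Real.sqrt 2 ^ n) ^ 2 = 16 * (Fintype.card K : ℝ) := by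
    rw [hN, mul_pow, ← pow_mul, mul_comm n 2, pow_mul, Real.sq_sqrt (by norm_num : (0 : ℝ) ≤ 2)]
    norm_num
  refine abs_le_of_sq_le_sq ?_ (by positivity)
  rw [hsq]
  exact hW2

/-- **Quadratic Walsh bound for `x ↦ Tr(γx + αx³ + βx⁵)`** (Gold 1968; Carlet 2021, ch. 11): in a
finite field of order `2ⁿ`, for `β ≠ 0` and all `α, γ`,
`|Σ_x (−1)^{Tr(γx + αx³ + βx⁵)}| ≤ 4·√2ⁿ` — the radical of the associated bilinear form has at most
`16` elements. This is the Fourier-side estimate of the lead's real-tilt analysis of `stub_coreFlat`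
(crux DeqThesis, line Sketch, `Lines/Sketch.md` §3), uniform in the input difference `d = β ≠ 0`. -/
theorem abs_walsh_gold_le {n : ℕ} (hK : Fintype.card K = 2 ^ n) {β : K} (hβ : β ≠ 0) (γ α : K) :
    |∑ x : K, (if Algebra.trace (ZMod 2) K (γ * x + α * x ^ 3 + β * x ^ 5) = 0 then (1 : ℝ) else -1)|
      ≤ 4 * Real.sqrt 2 ^ n :=
  abs_walsh_gold_le' (e := fun z => if Algebra.trace (ZMod 2) K z = 0 then (1 : ℝ) else -1)
    (fun _ => rfl) hK hβ γ α

end Trace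

end GoldWalsh

/-- **Registered sub-goal `stub_goldWalsh`** of the crux's line `Sketch` (toward `stub_coreFlat`):
the Gold-type quadratic Walsh bound, route-item style (`K : Type`, `ZMod 2`-algebra structure as in
`CubeAlmostBent`). -/
theorem stub_goldWalsh : ∀ (n : ℕ) (K : Type) [Field K] [Fintype K] [Algebra (ZMod 2) K], Fintype.card K = 2 ^ n → ∀ β : K, β ≠ 0 → ∀ γ α : K, |∑ x : K, (if Algebra.trace (ZMod 2) K (γ * x + α * x ^ 3 + β * x ^ 5) = 0 then (1 : ℝ) else -1)| ≤ 4 * Real.sqrt 2 ^ n :=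
  fun _ _ _ _ _ hK _ hβ γ α => GoldWalsh.abs_walsh_gold_le hK hβ γ α

namespace GoldWalsh

open CubeAlmostBent

/-! ### The same bound with an arbitrary additive functional in the phase

Adding `φ x` for an ADDITIVE `φ : K →+ ZMod 2` (coordinate parities, `Tr(εx²)`, …) changes only the
outer factor of the squared sum (`φ (x + u) + φ x = φ u`), not the inner character sum; so the bound
is unchanged. This is the form consumed by the real-tilt core argument, where the linear part of the
pair phase is a coordinate functional of no particular field shape. -/

section TraceAdd

variable {K : Type*} [Field K] [Algebra (ZMod 2) K]

omit [Algebra (ZMod 2) K] in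
/-- The sign character of `ZMod 2` applied to an additive functional is multiplicative. -/
theorem chi_apply_add (φ : K →+ ZMod 2) (x u : K) :
    (if φ (x + u) = 0 then (1 : ℝ) else -1) =
      (if φ x = 0 then (1 : ℝ) else -1) * (if φ u = 0 then (1 : ℝ) else -1) := by
  rw [map_add, chi_add]

variable [Fintype K]

/-- Squared Walsh sum with an additive functional in the phase: the inner sum is the same as without it. -/
theorem walsh_sq_eq_gold_add {e : K → ℝ}
    (he : ∀ z, e z = if Algebra.trace (ZMod 2) K z = 0 then (1 : ℝ) else -1)
    (φ : K →+ ZMod 2) (α β : K) :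
    (∑ x : K, (if φ x = 0 then (1 : ℝ) else -1) * e (α * x ^ 3 + β * x ^ 5)) ^ 2 =
      ∑ u : K, ((if φ u = 0 then (1 : ℝ) else -1) * e (α * u ^ 3 + β * u ^ 5)) *
        ∑ x : K, e (α * u * x ^ 2 + α * u ^ 2 * x + β * u * x ^ 4 + β * u ^ 4 * x) := by
  haveI : CharP K 2 := charP_two_of_algebra
  have hsq1 : ∀ x : K, (if φ x = 0 then (1 : ℝ) else -1) * (if φ x = 0 then (1 : ℝ) else -1) = 1 := by
    intro x; split_ifs <;> norm_num
  have hshift : ∀ x u : K,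
      ((if φ x = 0 then (1 : ℝ) else -1) * e (α * x ^ 3 + β * x ^ 5)) *
        ((if φ (x + u) = 0 then (1 : ℝ) else -1) * e (α * (x + u) ^ 3 + β * (x + u) ^ 5)) =
      ((if φ u = 0 then (1 : ℝ) else -1) * e (α * u ^ 3 + β * u ^ 5)) *
        e (α * u * x ^ 2 + α * u ^ 2 * x + β * u * x ^ 4 + β * u ^ 4 * x) := by
    intro x u
    have h0 := e_mul_e_shift_gold he 0 α β x u
    simp only [zero_mul, zero_add] at h0
    rw [chi_apply_add]
    calc (if φ x = 0 then (1 : ℝ) else -1) * e (α * x ^ 3 + β * x ^ 5) *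
          ((if φ x = 0 then (1 : ℝ) else -1) * (if φ u = 0 then (1 : ℝ) else -1) *
            e (α * (x + u) ^ 3 + β * (x + u) ^ 5))
        = ((if φ x = 0 then (1 : ℝ) else -1) * (if φ x = 0 then (1 : ℝ) else -1)) *
            (if φ u = 0 then (1 : ℝ) else -1) *
            (e (α * x ^ 3 + β * x ^ 5) * e (α * (x + u) ^ 3 + β * (x + u) ^ 5)) := by ring
      _ = (if φ u = 0 then (1 : ℝ) else -1) * e (α * u ^ 3 + β * u ^ 5) *
            e (α * u * x ^ 2 + α * u ^ 2 * x + β * u * x ^ 4 + β * u ^ 4 * x) := by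
          rw [hsq1, one_mul, h0, ← mul_assoc]
  rw [sq, Fintype.sum_mul_sum]
  calc ∑ x : K, ∑ y : K, ((if φ x = 0 then (1 : ℝ) else -1) * e (α * x ^ 3 + β * x ^ 5)) *
          ((if φ y = 0 then (1 : ℝ) else -1) * e (α * y ^ 3 + β * y ^ 5))
      = ∑ x : K, ∑ u : K, ((if φ u = 0 then (1 : ℝ) else -1) * e (α * u ^ 3 + β * u ^ 5)) *
          e (α * u * x ^ 2 + α * u ^ 2 * x + β * u * x ^ 4 + β * u ^ 4 * x) := by
        refine Finset.sum_congr rfl fun x _ => ?_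
        refine (Fintype.sum_equiv (Equiv.addLeft x) _ _ fun u => ?_).symm
        exact (hshift x u).symm
    _ = ∑ u : K, ∑ x : K, ((if φ u = 0 then (1 : ℝ) else -1) * e (α * u ^ 3 + β * u ^ 5)) *
          e (α * u * x ^ 2 + α * u ^ 2 * x + β * u * x ^ 4 + β * u ^ 4 * x) :=
        Finset.sum_comm
    _ = ∑ u : K, ((if φ u = 0 then (1 : ℝ) else -1) * e (α * u ^ 3 + β * u ^ 5)) *
          ∑ x : K, e (α * u * x ^ 2 + α * u ^ 2 * x + β * u * x ^ 4 + β * u ^ 4 * x) :=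
        Finset.sum_congr rfl fun u _ => (Finset.mul_sum _ _ _).symm

/-- **Gold-type quadratic Walsh bound with an additive functional** (abstract form): for `|K| = 2ⁿ`,
`β ≠ 0`, any `α` and any additive `φ : K →+ ZMod 2`,
`|Σ_x (−1)^{φ x + Tr(αx³ + βx⁵)}| ≤ 4·√2ⁿ`. -/
theorem abs_walsh_gold_add_le' {e : K → ℝ}
    (he : ∀ z, e z = if Algebra.trace (ZMod 2) K z = 0 then (1 : ℝ) else -1)
    {n : ℕ} (hK : Fintype.card K = 2 ^ n) {β : K} (hβ : β ≠ 0) (α : K) (φ : K →+ ZMod 2) :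
    |∑ x : K, (if φ x = 0 then (1 : ℝ) else -1) * e (α * x ^ 3 + β * x ^ 5)| ≤
      4 * Real.sqrt 2 ^ n := by
  classical
  set W := ∑ x : K, (if φ x = 0 then (1 : ℝ) else -1) * e (α * x ^ 3 + β * x ^ 5) with hW
  have hN : (Fintype.card K : ℝ) = 2 ^ n := by exact_mod_cast hK
  have habs1 : ∀ u : K, |(if φ u = 0 then (1 : ℝ) else -1) * e (α * u ^ 3 + β * u ^ 5)| ≤ 1 := by
    intro u
    rw [abs_mul]
    have h1 : |(if φ u = 0 then (1 : ℝ) else -1)| ≤ 1 := by split_ifs <;> norm_num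
    exact mul_le_one₀ h1 (abs_nonneg _) (abs_e_le he _)
  have hterm : ∀ u : K,
      |((if φ u = 0 then (1 : ℝ) else -1) * e (α * u ^ 3 + β * u ^ 5)) *
          ∑ x : K, e (α * u * x ^ 2 + α * u ^ 2 * x + β * u * x ^ 4 + β * u ^ 4 * x)| ≤
        if β ^ 4 * u ^ 16 + α ^ 4 * u ^ 8 + α ^ 2 * u ^ 2 + β * u = 0 then (Fintype.card K : ℝ)
        else 0 := by
    intro u
    rw [inner_sum_eq_gold he, abs_mul]
    by_cases hu : β ^ 4 * u ^ 16 + α ^ 4 * u ^ 8 + α ^ 2 * u ^ 2 + β * u = 0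
    · rw [if_pos hu, hu, sum_e_zero_mul he, Nat.abs_cast]
      calc |(if φ u = 0 then (1 : ℝ) else -1) * e (α * u ^ 3 + β * u ^ 5)| * (Fintype.card K : ℝ)
          ≤ 1 * (Fintype.card K : ℝ) := mul_le_mul_of_nonneg_right (habs1 u) (Nat.cast_nonneg _)
        _ = (Fintype.card K : ℝ) := one_mul _
    · rw [if_neg hu, sum_e_mul_eq_zero he hu, abs_zero, mul_zero]
  have hW2 : W ^ 2 ≤ 16 * (Fintype.card K : ℝ) := by
    calc W ^ 2 = |W ^ 2| := (abs_of_nonneg (sq_nonneg W)).symm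
      _ = |∑ u : K, ((if φ u = 0 then (1 : ℝ) else -1) * e (α * u ^ 3 + β * u ^ 5)) *
            ∑ x : K, e (α * u * x ^ 2 + α * u ^ 2 * x + β * u * x ^ 4 + β * u ^ 4 * x)| := by
          rw [hW, walsh_sq_eq_gold_add he]
      _ ≤ ∑ u : K, |((if φ u = 0 then (1 : ℝ) else -1) * e (α * u ^ 3 + β * u ^ 5)) *
            ∑ x : K, e (α * u * x ^ 2 + α * u ^ 2 * x + β * u * x ^ 4 + β * u ^ 4 * x)| :=
          Finset.abs_sum_le_sum_abs _ _
      _ ≤ ∑ u : K, (if β ^ 4 * u ^ 16 + α ^ 4 * u ^ 8 + α ^ 2 * u ^ 2 + β * u = 0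
            then (Fintype.card K : ℝ) else 0) :=
          Finset.sum_le_sum fun u _ => hterm u
      _ = ((Finset.univ.filter fun u : K =>
              β ^ 4 * u ^ 16 + α ^ 4 * u ^ 8 + α ^ 2 * u ^ 2 + β * u = 0).card : ℝ) *
            (Fintype.card K : ℝ) := by
          rw [← Finset.sum_filter, Finset.sum_const, nsmul_eq_mul]
      _ ≤ 16 * (Fintype.card K : ℝ) := by
          gcongr
          exact_mod_cast card_le_sixteen_of_additive α β hβ _
            fun u hu => (Finset.mem_filter.mp hu).2
  have hsq : (4 * Real.sqrt 2 ^ n) ^ 2 = 16 * (Fintype.card K : ℝ) := by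
    rw [hN, mul_pow, ← pow_mul, mul_comm n 2, pow_mul, Real.sq_sqrt (by norm_num : (0 : ℝ) ≤ 2)]
    norm_num
  refine abs_le_of_sq_le_sq ?_ (by positivity)
  rw [hsq]
  exact hW2

/-- **Gold-type quadratic Walsh bound with an additive functional**: in a finite field of order `2ⁿ`,
for `β ≠ 0`, any `α` and any additive `φ : K →+ ZMod 2`,
`|Σ_x (−1)^{φ x + Tr(αx³ + βx⁵)}| ≤ 4·√2ⁿ`. -/
theorem abs_walsh_gold_add_le {n : ℕ} (hK : Fintype.card K = 2 ^ n) {β : K} (hβ : β ≠ 0) (α : K)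
    (φ : K →+ ZMod 2) :
    |∑ x : K, (if φ x + Algebra.trace (ZMod 2) K (α * x ^ 3 + β * x ^ 5) = 0 then (1 : ℝ) else -1)|
      ≤ 4 * Real.sqrt 2 ^ n := by
  have h := abs_walsh_gold_add_le' (e := fun z => if Algebra.trace (ZMod 2) K z = 0 then (1 : ℝ) else -1)
    (fun _ => rfl) hK hβ α φ
  have hre : ∀ x : K, (if φ x + Algebra.trace (ZMod 2) K (α * x ^ 3 + β * x ^ 5) = 0 then (1 : ℝ) else -1) =
      (if φ x = 0 then (1 : ℝ) else -1) *
        (if Algebra.trace (ZMod 2) K (α * x ^ 3 + β * x ^ 5) = 0 then (1 : ℝ) else -1) := fun x =>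
    chi_add _ _
  simp_rw [hre]
  exact h

end TraceAdd

end GoldWalsh

end Summit.QuantumAdvantage.QuantumAdvantage.Theorems.SymplecticPurity
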